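import Mathlib.RingTheory.RootsOfUnity.Complex
import Literature.NumberTheory.Transcendental.PseudoExpChain
import Literature.NumberTheory.Transcendental.PseudoExpAmbient
import Literature.NumberTheory.Transcendental.ZilberFieldExistenceProofs
import Literature.NumberTheory.Transcendental.EclPredim
import HarnessLib

/-!
# The free ELA-closure of `SK` inside `ℂ`: standard kernel, Schanuel property, ELA, infinite
dimension (Kirby 2013 FPEF, §2)

For the exponential field `(Ω, exp)`, `exp = cexp ∘ Λ∞` (`Einf`), of `PseudoExpChain.lean` — Kirby's
free ELA-closure `SK^{ELA}` (J. Kirby, *Finitely presented exponential fields*, Algebra & Number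
Theory 7 (2013), Constructions 2.6, 2.11, 2.13) built along an enumeration inside a countable
algebraically closed `Ω ⊆ ℂ`, with extra exponentially transcendental generators — we prove:

**Part I — the kernel is standard.** "Any partial E-field `F` with full kernel can be extended to
an ELA-field without adding new kernel elements" (§2, before Construction 2.13): along the chain,
`cexp (Λₖ x) = 1` for `x ∈ Dₖ` forces `x ∈ ℤ · 2πi` (`kInv_chain`; the exponential step because the
new exponential is transcendental over the old partial E-field, the logarithm step because an
element one of whose powers is an old exponential already has a logarithm — the image contains
the roots of unity `cexp(2πi j/m) = E((j/m)τ)`, Prop. 2.12), whence `Einf x = 1 ↔ x ∈ ℤ · 2πi`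
(`Einf_eq_one_iff`) and `ker exp = τℤ` with `τ = 2πi` transcendental (`expKernel_eq`,
`hasStandardKernel`).

**Part II — strongness and the axioms.**
* every step is a strong extension (Lemma 2.14: "for any `ȳ` from `D(F^e)`, `δ(ȳ/D(F)) = 0`. Hence
  `F ◁ F^e`. `F ◁ F^l` by the same argument"; here `δ = td - 1 ≥ 0` for the one new basis vector):
  `predim_step_nonneg`;
* hence every stage is strong in the union (Lemma 2.3: composites and unions of chains of strong
  extensions), `isStrong_D_chain`; in particular `SK = ℚ · 2πi ◁ (Ω, exp)`, which is the
  Schanuel property (`schanuelProperty`, via `schanuelProperty_iff_isStrong_span_kernelGenerator`);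
* `exp` is onto `Ωˣ` (`isSurjectiveOntoUnits`: every `b` has its logarithm task); `Ω` is
  algebraically closed and countable;
* infinite dimension: no finite set is `ecl`-spanning (`ecl_ne_univ`): a generic generator `a`
  adjoined at a stage beyond the finite set has `δ(ℚa/D) = 1`, while elements of `ecl D` lie in
  finitely generated `Y ⊇ D` with `δ(Y/D) ≤ 0` (Kirby 2010; `GammaField.exists_predim_le_zero_of_mem_ecl_coe`).

Assembled: `PseudoExpChain.exists_countable_ELA_schanuel` — **there is a countable ELA-field with
standard kernel, the Schanuel property and infinite `ecl`-dimension** (the countable kernel-preserving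
strong ELA-extensions of `SK` of Kirby 2013, §2). This is the first half of the countable
pseudo-exponential field (which is in addition strongly exponentially-algebraically closed:
ibid. §6; Bays–Kirby 2018, Thm 5.9), towards `exists_isZilberField_of_aleph0_lt`.

## References

* J. Kirby, *Finitely presented exponential fields*, Algebra & Number Theory 7 (2013) 943–980,
  arXiv:0912.4019: Lemma 2.3, Constructions 2.6, 2.11, 2.13, Prop. 2.12, Lemma 2.14 and the
  remark before Construction 2.13.
* J. Kirby, *Exponential algebraicity in exponential fields*, Bull. LMS 42 (2010), Thm 1.3.
* M. Bays, J. Kirby, *Pseudo-exponential maps, variants, and quasiminimality*, Algebra & Number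
  Theory 12 (2018), Thm 9.1 (proof: the two forms of axiom 3).
-/

noncomputable section

open Set Complex

namespace Literature.NumberTheory.Transcendental

namespace PseudoExpChain

open GammaField

variable {A : AmbientData}

/-! ## Part I: the kernel is standard

### Algebraic bookkeeping in `ℂ` -/

/-- If `t ^ p = c` with `p ≠ 0` then `t` is algebraic over `c`. [folklore] -/
theorem mem_acl_of_zpow_eq {t c : ℂ} {p : ℤ} (hp : p ≠ 0) (h : t ^ p = c) :
    t ∈ acl ({c} : Set ℂ) := by
  rcases lt_trichotomy p 0 with hlt | rfl | hgt
  · -- `t ^ (-p) = c⁻¹`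
    have hn : 0 < (-p).toNat := by omega
    refine mem_acl_of_pow_mem (Nat.pos_iff_ne_zero.1 hn) ?_
    have : t ^ (-p).toNat = c⁻¹ := by
      rw [← zpow_natCast, Int.toNat_of_nonneg (by omega), zpow_neg, h]
    rw [this]
    exact inv_mem_acl (subset_acl _ (mem_singleton c))
  · exact (hp rfl).elim
  · refine mem_acl_of_pow_mem (Nat.pos_iff_ne_zero.1 (by omega : 0 < p.toNat)) ?_
    have : t ^ p.toNat = c := by
      rw [← zpow_natCast, Int.toNat_of_nonneg hgt.le, h]
    rw [this]
    exact subset_acl _ (mem_singleton c)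

namespace PState

/-- The exponentials `E x`, `x ∈ D`, are algebraic over `genℂ`. [folklore] -/
theorem E_mem_acl_genℂ {σ : PState A} (h : σ.Inv) {x : A.Ω} (hx : x ∈ σ.D) :
    σ.E x ∈ acl σ.genℂ := by
  induction hx using Submodule.span_induction with
  | mem v hv => rw [E_of_mem h.good hv]; exact subset_acl _ (σ.cexp_mem_genℂ hv)
  | zero => rw [E_zero]; exact one_mem_acl _
  | add x y _ _ hx hy => rw [E_add]; exact mul_mem_acl hx hy
  | smul q x _ hx =>
    rw [E, map_smul]
    exact acl_subset_acl_of_subset (singleton_subset_iff.2 hx) (cexp_smul_mem_acl q _)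

/-- On rational multiples of `τ` the exponential is `cexp`: `E (q • τ) = cexp (q • 2πi)`, provided
`Λ τ = 2πi`. [cite: Kirby2013FPEF, Construction 2.11 (exp(τ/m) the coherent primitive roots of unity)] -/
theorem E_smul_τ {σ : PState A} (h : σ.Inv) (q : ℚ) :
    σ.E (q • A.τ) = cexp (q • (2 * Real.pi * Complex.I)) := by
  rw [E, map_smul, Λ_apply_of_mem h.good h.τ_mem, h.w_τ]

/-- **One free step preserves the kernel** (Kirby: kernel-preserving extensions): if no non-zero
power of `cexp ω` is an old exponential, then adjoining `a ∉ D` with logarithm `ω` creates no new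
kernel elements. Proof: `E(d + q a) = E d · cexp (q ω) = 1` gives, raising to the denominator of
`q`, `cexp(ω)^{num q} = E(-den q · d)`, so `num q = 0`.
[cite: Kirby2013FPEF, §2 (remark before Construction 2.13) and Construction 2.6] -/
theorem kInv_adjoin {σ : PState A} (hK : ∀ x ∈ σ.D, σ.E x = 1 → ∃ n : ℤ, x = n • A.τ)
    (h : σ.Inv) {a : A.Ω} (ha : a ∉ σ.D) {ω : ℂ} (hω : cexp ω ∈ A.Ω)
    (H : ∀ p : ℤ, p ≠ 0 → ∀ d ∈ σ.D, cexp ω ^ p ≠ σ.E d) :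
    ∀ x ∈ (σ.adjoin a ω).D, (σ.adjoin a ω).E x = 1 → ∃ n : ℤ, x = n • A.τ := by
  classical
  have h' : (σ.adjoin a ω).Inv := h.adjoin ha hω
  have hle : σ.LE (σ.adjoin a ω) := σ.le_adjoin (fun hs => ha (σ.subset_D hs)) ω
  intro x hx hEx
  rw [adjoin_D, Submodule.mem_sup] at hx
  obtain ⟨d, hd, y, hy, rfl⟩ := hx
  obtain ⟨q, rfl⟩ := Submodule.mem_span_singleton.1 hy
  -- `E'(d + q a) = E d * cexp (q • ω)`
  have hEa : (σ.adjoin a ω).E a = cexp ω := by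
    rw [E_of_mem h'.good (by simp), adjoin_w_self]
  have hEd : (σ.adjoin a ω).E d = σ.E d := hle.E_eq h.good h'.good hd
  have hEqa : (σ.adjoin a ω).E (q • a) = cexp (q • ω) := by
    rw [E, map_smul, Λ_apply_of_mem h'.good (by simp), adjoin_w_self]
  have hE : σ.E d * cexp (q • ω) = 1 := by
    rw [← hEx, E_add, hEd, hEqa]
  -- raise to the power `den q`
  have hpow : σ.E ((q.den : ℚ) • d) * cexp ω ^ q.num = 1 := by
    have h1 : (σ.E d * cexp (q • ω)) ^ q.den = 1 := by rw [hE, one_pow]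
    rw [mul_pow] at h1
    have h2 : σ.E d ^ q.den = σ.E ((q.den : ℚ) • d) := by
      rw [E, E, map_smul, Nat.cast_smul_eq_nsmul ℚ, nsmul_eq_mul, Complex.exp_nat_mul]
    have h3 : cexp (q • ω) ^ q.den = cexp ω ^ q.num := by
      rw [← Complex.exp_nat_mul, ← Complex.exp_int_mul]
      congr 1
      rw [Rat.smul_def, ← mul_assoc]
      congr 1
      have h := Rat.mul_den_eq_num q
      have h' : ((q.den : ℚ) * q : ℂ) = (q.num : ℂ) := by rw [mul_comm]; exact_mod_cast h
      push_cast at h' ⊢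
      exact h'
    rw [h2, h3] at h1
    exact h1
  -- hence `cexp ω ^ num q = E (-(den q) • d)`, so `num q = 0`
  have hnum : q.num = 0 := by
    by_contra hne
    refine H q.num hne (-((q.den : ℚ) • d)) (Submodule.neg_mem _ (Submodule.smul_mem _ _ hd)) ?_
    have hne0 : σ.E ((q.den : ℚ) • d) ≠ 0 := E_ne_zero _ _
    rw [E, map_neg, Complex.exp_neg, ← E]
    field_simp
    rw [mul_comm] at hpow
    exact hpow
  have hq : q = 0 := Rat.zero_of_num_zero hnum
  subst hq
  rw [zero_smul, add_zero] at hEx ⊢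
  rw [hEd] at hEx
  exact hK d hd hEx

/-- The kernel of `SK` itself: `cexp (q • 2πi) = 1` iff `q ∈ ℤ`. [cite: Kirby2013FPEF, Construction 2.11] -/
theorem kInv_init : ∀ x ∈ (init A).D, (init A).E x = 1 → ∃ n : ℤ, x = n • A.τ := by
  intro x hx hEx
  have hx' : x ∈ Submodule.span ℚ ({A.τ} : Set A.Ω) := by
    simpa [init, D] using hx
  obtain ⟨q, rfl⟩ := Submodule.mem_span_singleton.1 hx'
  rw [E_smul_τ inv_init, Complex.exp_eq_one_iff] at hEx
  obtain ⟨n, hn⟩ := hEx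
  have hq : (q : ℂ) = n := by
    have h2 : (2 * Real.pi * Complex.I : ℂ) ≠ 0 := by
      have hpi : (Real.pi : ℂ) ≠ 0 := Complex.ofReal_ne_zero.2 Real.pi_ne_zero
      exact mul_ne_zero (mul_ne_zero two_ne_zero hpi) Complex.I_ne_zero
    rw [Rat.smul_def] at hn
    exact mul_right_cancel₀ h2 hn
  have hq' : q = n := by exact_mod_cast hq
  refine ⟨n, ?_⟩
  rw [hq', Int.cast_smul_eq_zsmul]

end PState

/-! ### The three steps are kernel-preserving -/

namespace PState

/-- A fresh transcendental exponential has no power among the old exponentials.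
[cite: Kirby2013FPEF, Construction 2.6 (the c_{i,1} algebraically independent over F)] -/
theorem H_of_fresh {σ : PState A} (h : σ.Inv) {t : ℂ} (ht : t ∉ acl σ.genℂ) :
    ∀ p : ℤ, p ≠ 0 → ∀ d ∈ σ.D, t ^ p ≠ σ.E d := by
  intro p hp d hd heq
  refine ht (acl_subset_acl_of_subset ?_ (mem_acl_of_zpow_eq hp heq))
  exact singleton_subset_iff.2 (E_mem_acl_genℂ h hd)

/-- The exponential step is kernel-preserving. [cite: Kirby2013FPEF, Construction 2.6 and §2 (kernel-preserving)] -/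
theorem kInv_stepExp {σ : PState A} (hK : ∀ x ∈ σ.D, σ.E x = 1 → ∃ n : ℤ, x = n • A.τ)
    (h : σ.Inv) (a : A.Ω) :
    ∀ x ∈ (σ.stepExp a).D, (σ.stepExp a).E x = 1 → ∃ n : ℤ, x = n • A.τ := by
  classical
  unfold PState.stepExp
  split_ifs with ha
  · exact hK
  · have ht := A.fresh_notMem (σ.genℂ ∪ {(a : ℂ)}) (σ.genℂ_finite.union (finite_singleton _))
    have ht0 := A.fresh_ne_zero (σ.genℂ ∪ {(a : ℂ)}) (σ.genℂ_finite.union (finite_singleton _))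
    refine kInv_adjoin hK h ha ?_ ?_
    · rw [Complex.exp_log ht0]; exact (A.fresh _ _).2
    · rw [Complex.exp_log ht0]
      exact H_of_fresh h (fun hm => ht (acl_mono subset_union_left hm))

/-- The generic step is kernel-preserving. [cite: Kirby2013FPEF, Construction 2.6 and §2 (kernel-preserving)] -/
theorem kInv_stepGen {σ : PState A} (hK : ∀ x ∈ σ.D, σ.E x = 1 → ∃ n : ℤ, x = n • A.τ)
    (h : σ.Inv) : ∀ x ∈ σ.stepGen.D, σ.stepGen.E x = 1 → ∃ n : ℤ, x = n • A.τ := by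
  have ht := A.fresh_notMem (σ.genℂ ∪ {(A.fresh σ.genℂ σ.genℂ_finite : ℂ)})
    (σ.genℂ_finite.union (finite_singleton _))
  have ht0 := A.fresh_ne_zero (σ.genℂ ∪ {(A.fresh σ.genℂ σ.genℂ_finite : ℂ)})
    (σ.genℂ_finite.union (finite_singleton _))
  refine kInv_adjoin hK h (σ.fresh_notMem_D _ le_rfl) ?_ ?_
  · rw [Complex.exp_log ht0]; exact (A.fresh _ _).2
  · rw [Complex.exp_log ht0]
    exact H_of_fresh h (fun hm => ht (acl_mono subset_union_left hm))

/-- **Adjoining a logarithm is kernel-preserving** (Construction 2.13: `b` is multiplicatively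
independent from the old image): if `b` has no logarithm in `D` then no non-zero power of `b` is an
old exponential — otherwise `b^m = E(d)` and `b = E(d/m) · ζ` with `ζ` an `m`-th root of unity, i.e.
`ζ = cexp(2πi j/m) = E((j/m) τ)`, so `b = E(d/m + (j/m)τ)` would have a logarithm.
[cite: Kirby2013FPEF, Construction 2.13 and Prop. 2.12 (full kernel: the image contains μ)] -/
theorem H_of_no_log {σ : PState A} (h : σ.Inv) {b : A.Ω} (hb0 : b ≠ 0)
    (hb : ¬ ∃ x ∈ σ.D, σ.E x = b) :
    ∀ p : ℤ, p ≠ 0 → ∀ d ∈ σ.D, (b : ℂ) ^ p ≠ σ.E d := by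
  classical
  -- reduce to positive powers
  suffices key : ∀ m : ℕ, m ≠ 0 → ∀ d ∈ σ.D, (b : ℂ) ^ m ≠ σ.E d by
    intro p hp d hd heq
    rcases lt_trichotomy p 0 with hlt | rfl | hgt
    · refine key (-p).toNat (by omega) (-d) (Submodule.neg_mem _ hd) ?_
      rw [← zpow_natCast, Int.toNat_of_nonneg (by omega), zpow_neg, heq, E, E, map_neg,
        Complex.exp_neg]
    · exact (hp rfl).elim
    · refine key p.toNat (by omega) d hd ?_
      rw [← zpow_natCast, Int.toNat_of_nonneg hgt.le, heq]
  intro m hm d hd heq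
  have hb0' : (b : ℂ) ≠ 0 := fun h0 => hb0 (Subtype.ext h0)
  -- `y = E (d/m)` is an `m`-th root of `E d`
  set y : ℂ := σ.E ((m : ℚ)⁻¹ • d) with hy
  have hym : y ^ m = σ.E d := by
    rw [hy, E, E, map_smul, ← Complex.exp_nat_mul]
    congr 1
    rw [Rat.smul_def]
    push_cast
    field_simp
  have hy0 : y ≠ 0 := E_ne_zero _ _
  -- `b / y` is an `m`-th root of unity, hence `cexp (2πi j / m)`
  have hroot : ((b : ℂ) / y) ^ m = 1 := by
    rw [div_pow, heq, hym]
    exact div_self (E_ne_zero _ _)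
  haveI : NeZero m := ⟨hm⟩
  have hunit : IsUnit ((b : ℂ) / y) := isUnit_iff_ne_zero.2 (div_ne_zero hb0' hy0)
  obtain ⟨j, -, hj⟩ := (Complex.mem_rootsOfUnity m hunit.unit).1 (by
    rw [_root_.mem_rootsOfUnity, Units.ext_iff, Units.val_pow_eq_pow_val, IsUnit.unit_spec,
      Units.val_one]
    exact hroot)
  -- so `b = E ((1/m) d + (j/m) τ)`
  refine hb ⟨(m : ℚ)⁻¹ • d + ((j : ℚ) / m) • A.τ, Submodule.add_mem _ (Submodule.smul_mem _ _ hd)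
    (Submodule.smul_mem _ _ (σ.subset_D h.τ_mem)), ?_⟩
  rw [E_add, ← hy, E_smul_τ h]
  have hj' : cexp (2 * Real.pi * Complex.I * (j / m)) = (b : ℂ) / y := by
    rw [hj, IsUnit.unit_spec]
  have : cexp (((j : ℚ) / m : ℚ) • (2 * Real.pi * Complex.I)) = (b : ℂ) / y := by
    rw [← hj', Rat.smul_def]
    push_cast
    ring_nf
  rw [this, mul_div_cancel₀ _ hy0]

/-- The logarithm step is kernel-preserving. [cite: Kirby2013FPEF, Construction 2.13 and §2 (kernel-preserving)] -/
theorem kInv_stepLog {σ : PState A} (hK : ∀ x ∈ σ.D, σ.E x = 1 → ∃ n : ℤ, x = n • A.τ)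
    (h : σ.Inv) (b : A.Ω) :
    ∀ x ∈ (σ.stepLog b).D, (σ.stepLog b).E x = 1 → ∃ n : ℤ, x = n • A.τ := by
  classical
  unfold PState.stepLog
  split_ifs with hb
  · exact hK
  · push Not at hb
    have hb0 : (b : ℂ) ≠ 0 := fun h0 => hb.1 (Subtype.ext h0)
    refine kInv_adjoin hK h (σ.fresh_notMem_D _ subset_union_left) ?_ ?_
    · rw [Complex.exp_log hb0]; exact b.2
    · rw [Complex.exp_log hb0]
      exact H_of_no_log h hb.1 (fun ⟨x, hx, hEx⟩ => hb.2 x hx hEx)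

end PState

/-- **The kernel invariant holds along the chain.** [cite: Kirby2013FPEF, §2 (kernel-preserving ELA-closure)] -/
theorem kInv_chain : ∀ k, ∀ x ∈ (chain A k).D, (chain A k).E x = 1 → ∃ n : ℤ, x = n • A.τ
  | 0 => PState.kInv_init
  | k + 1 => by
    rw [chain_succ]
    rcases task A k with a | b | j
    · exact PState.kInv_stepExp (kInv_chain k) (inv_chain k) a
    · exact PState.kInv_stepLog (kInv_chain k) (inv_chain k) b
    · exact PState.kInv_stepGen (kInv_chain k) (inv_chain k)

/-- **The kernel of `Einf` is `ℤ · 2πi`.** [cite: Kirby2013FPEF, Construction 2.11 and §2] -/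
theorem Einf_eq_one_iff (x : A.Ω) : Einf x = 1 ↔ ∃ n : ℤ, x = n • A.τ := by
  constructor
  · intro h
    obtain ⟨k, hk⟩ := exists_mem_D x
    rw [Einf_eq hk] at h
    exact kInv_chain k x hk h
  · rintro ⟨n, rfl⟩
    have hmem : (n : ℚ) • A.τ ∈ (chain A 0).D := Submodule.smul_mem _ _ (τ_mem_D 0)
    have hcast : (n • A.τ : A.Ω) = (n : ℚ) • A.τ := (Int.cast_smul_eq_zsmul ℚ n A.τ).symm
    rw [hcast, Einf_eq hmem]
    show (init A).E ((n : ℚ) • A.τ) = 1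
    rw [PState.E_smul_τ inv_init, Complex.exp_eq_one_iff]
    exact ⟨n, by rw [Rat.smul_def]; push_cast; ring⟩


/-! ## Part II: strongness, the axioms, and the countable ELA-field -/

section Axioms

open Matroid
open Literature.ModelTheory.ExponentialFields Literature.ModelTheory.ExponentialFields.ExponentialRing

/-- **Ambient data exist** (`PseudoExpAmbient.exists_ambient`). [folklore] -/
theorem AmbientData.nonempty : Nonempty AmbientData := by
  obtain ⟨Ω, h1, h2, h3, h4, h5⟩ := PseudoExpAmbient.exists_ambient
  exact ⟨⟨Ω, h1, h2, h3, h4, h5⟩⟩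

variable {A : AmbientData}

/-! ### The exponential on the stages -/

/-- The exponential on a stage is the partial exponential of that stage. [folklore] -/
theorem coe_exp_eq_E {k : ℕ} {x : A.Ω} (hx : x ∈ (chain A k).D) :
    ((ExponentialRing.exp x : A.Ω) : ℂ) = (chain A k).E x := by
  rw [coe_exp, Einf_eq hx]

/-- The closure of `gens Dₖ ∪ T` in the algebraic matroid of `Ω` consists of elements algebraic (in
`ℂ`) over `genℂ σₖ ∪ T`. [folklore] -/
theorem closure_union_gens_subset (k : ℕ) (T : Set A.Ω) :
    ∀ y ∈ (algMatroid A.Ω).closure (T ∪ gens (chain A k).D),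
      (y : ℂ) ∈ acl ((chain A k).genℂ ∪ ((↑) : A.Ω → ℂ) '' T) := by
  intro y hy
  change y ∈ acl (T ∪ gens (chain A k).D) at hy
  rw [PseudoExpAmbient.acl_eq_preimage, mem_preimage] at hy
  refine acl_subset_acl_of_subset ?_ hy
  rintro _ ⟨z, hz, rfl⟩
  rcases hz with hzT | hzD | ⟨x, hxD, rfl⟩
  · exact subset_acl _ (Or.inr ⟨z, hzT, rfl⟩)
  · exact acl_mono subset_union_left ((chain A k).coe_mem_acl_genℂ hzD)
  · rw [coe_exp_eq_E hxD]
    exact acl_mono subset_union_left (PState.E_mem_acl_genℂ (inv_chain k) hxD)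

/-- Specialisation: the closure of `gens Dₖ`. [folklore] -/
theorem closure_gens_subset (k : ℕ) :
    ∀ y ∈ (algMatroid A.Ω).closure (gens (chain A k).D), (y : ℂ) ∈ acl (chain A k).genℂ := by
  intro y hy
  have h := closure_union_gens_subset k ∅ y (by rwa [empty_union])
  rwa [image_empty, union_empty] at h

/-- Specialisation: the closure of `{a} ∪ gens Dₖ`. [folklore] -/
theorem closure_insert_gens_subset (k : ℕ) (a : A.Ω) :
    ∀ y ∈ (algMatroid A.Ω).closure ({a} ∪ gens (chain A k).D),
      (y : ℂ) ∈ acl ((chain A k).genℂ ∪ {(a : ℂ)}) := by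
  intro y hy
  have h := closure_union_gens_subset k {a} y hy
  rwa [image_singleton] at h

/-! ### One step: the new basis vector and the rank of `{a, ExponentialRing.exp a}` -/

/-- **Description of one step of the chain**: either the domain does not change, or exactly one new
basis vector `a ∉ Dₖ` is adjoined, and then `{a, ExponentialRing.exp a}` has relative rank `≥ 1` over the old
Γ-field (the new exponential, resp. the new logarithm, is transcendental over it).
[cite: Kirby2013FPEF, Lemma 2.14 (proof: δ(ȳ/D(F)) = 0 for F^e, F^l)] -/
theorem chain_succ_D (k : ℕ) :
    (chain A (k + 1)).D = (chain A k).D ∨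
      ∃ a : A.Ω, a ∉ (chain A k).D ∧ (chain A (k + 1)).D = (chain A k).D ⊔ Submodule.span ℚ {a} ∧
        1 ≤ (algMatroid A.Ω).relRank (gens (chain A k).D) {a, ExponentialRing.exp a} := by
  classical
  have hc : chain A (k + 1) = step (task A k) (chain A k) := rfl
  set σ := chain A k with hσ
  rcases htk : task A k with a | b | j
  · -- exponential step
    rw [htk] at hc
    change chain A (k + 1) = σ.stepExp a at hc
    unfold PState.stepExp at hc
    split_ifs at hc with ha
    · left; rw [hc]
    · right
      set t := A.fresh (σ.genℂ ∪ {(a : ℂ)}) (σ.genℂ_finite.union (finite_singleton _)) with ht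
      have ht0 : (t : ℂ) ≠ 0 := A.fresh_ne_zero _ _
      have haD' : a ∈ (chain A (k + 1)).D := by
        rw [hc, PState.adjoin_D]; exact Submodule.mem_sup_right (Submodule.mem_span_singleton_self a)
      have hexp : (ExponentialRing.exp a : A.Ω) = t := by
        apply Subtype.ext
        rw [coe_exp_eq_E haD', hc, PState.E_of_mem ((inv_chain k).adjoin ha
          (by rw [Complex.exp_log ht0]; exact t.2)).good (by simp), PState.adjoin_w_self,
          Complex.exp_log ht0]
      refine ⟨a, ha, by rw [hc, PState.adjoin_D], ?_⟩
      rw [hexp, pair_comm]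
      have htcl : (t : A.Ω) ∉ (algMatroid A.Ω).closure ({a} ∪ gens σ.D) := fun hmem =>
        A.fresh_notMem _ _ (closure_insert_gens_subset k a t hmem)
      rw [(algMatroid A.Ω).relRank_insert_eq_add_one (mem_univ _) htcl]
      exact le_add_self
  · -- logarithm step
    rw [htk] at hc
    change chain A (k + 1) = σ.stepLog b at hc
    unfold PState.stepLog at hc
    split_ifs at hc with hb
    · left; rw [hc]
    · right
      push Not at hb
      set a := A.fresh (σ.genℂ ∪ {(b : ℂ)}) (σ.genℂ_finite.union (finite_singleton _)) with ha
      have haD : a ∉ σ.D := σ.fresh_notMem_D _ subset_union_left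
      refine ⟨a, haD, by rw [hc, PState.adjoin_D], ?_⟩
      have hacl : (a : A.Ω) ∉ (algMatroid A.Ω).closure (gens σ.D) := fun hmem =>
        A.fresh_notMem _ _ (acl_mono subset_union_left (closure_gens_subset k a hmem))
      calc (1 : ℕ∞) = (algMatroid A.Ω).relRank (gens σ.D) {a} := by
            rw [← insert_empty_eq a, (algMatroid A.Ω).relRank_insert_eq_add_one (mem_univ _)
              (by rwa [empty_union]), relRank_empty, zero_add]
        _ ≤ (algMatroid A.Ω).relRank (gens σ.D) {a, ExponentialRing.exp a} :=
            (algMatroid A.Ω).relRank_mono_right _ (singleton_subset_iff.2 (mem_insert _ _))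
  · -- generic step
    rw [htk] at hc
    change chain A (k + 1) = σ.stepGen at hc
    unfold PState.stepGen at hc
    right
    set a := A.fresh σ.genℂ σ.genℂ_finite with ha
    have haD : a ∉ σ.D := σ.fresh_notMem_D _ le_rfl
    refine ⟨a, haD, by rw [hc, PState.adjoin_D], ?_⟩
    have hacl : (a : A.Ω) ∉ (algMatroid A.Ω).closure (gens σ.D) := fun hmem =>
      A.fresh_notMem _ _ (closure_gens_subset k a hmem)
    calc (1 : ℕ∞) = (algMatroid A.Ω).relRank (gens σ.D) {a} := by
          rw [← insert_empty_eq a, (algMatroid A.Ω).relRank_insert_eq_add_one (mem_univ _)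
            (by rwa [empty_union]), relRank_empty, zero_add]
      _ ≤ (algMatroid A.Ω).relRank (gens σ.D) {a, ExponentialRing.exp a} :=
          (algMatroid A.Ω).relRank_mono_right _ (singleton_subset_iff.2 (mem_insert _ _))

/-- **The generic step has predimension exactly one**: if the task at stage `l` is a generic task,
then `D_{l+1} = D_l + ℚa` with `a ∉ D_l` and `{a, ExponentialRing.exp a}` of relative rank `2` over the old
Γ-field. [cite: Kirby2013FPEF, Construction 2.6] -/
theorem chain_succ_D_of_gen {l : ℕ} {j : ℕ} (htk : task A l = Sum.inr (Sum.inr j)) :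
    ∃ a : A.Ω, a ∉ (chain A l).D ∧ (chain A (l + 1)).D = (chain A l).D ⊔ Submodule.span ℚ {a} ∧
      (algMatroid A.Ω).relRank (gens (chain A l).D) {a, ExponentialRing.exp a} = 2 := by
  classical
  have hc : chain A (l + 1) = step (task A l) (chain A l) := rfl
  set σ := chain A l with hσ
  rw [htk] at hc
  change chain A (l + 1) = σ.stepGen at hc
  unfold PState.stepGen at hc
  set a := A.fresh σ.genℂ σ.genℂ_finite with ha
  set t := A.fresh (σ.genℂ ∪ {(a : ℂ)}) (σ.genℂ_finite.union (finite_singleton _)) with ht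
  have ht0 : (t : ℂ) ≠ 0 := A.fresh_ne_zero _ _
  have haD : a ∉ σ.D := σ.fresh_notMem_D _ le_rfl
  have haD' : a ∈ (chain A (l + 1)).D := by
    rw [hc, PState.adjoin_D]; exact Submodule.mem_sup_right (Submodule.mem_span_singleton_self a)
  have hexp : (ExponentialRing.exp a : A.Ω) = t := by
    apply Subtype.ext
    rw [coe_exp_eq_E haD', hc, PState.E_of_mem ((inv_chain l).adjoin haD
      (by rw [Complex.exp_log ht0]; exact t.2)).good (by simp), PState.adjoin_w_self,
      Complex.exp_log ht0]
  refine ⟨a, haD, by rw [hc, PState.adjoin_D], ?_⟩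
  have hacl : (a : A.Ω) ∉ (algMatroid A.Ω).closure (gens σ.D) := fun hmem =>
    A.fresh_notMem _ _ (closure_gens_subset l a hmem)
  have htcl : (t : A.Ω) ∉ (algMatroid A.Ω).closure ({a} ∪ gens σ.D) := fun hmem =>
    A.fresh_notMem _ _ (closure_insert_gens_subset l a t hmem)
  rw [hexp, pair_comm, (algMatroid A.Ω).relRank_insert_eq_add_one (mem_univ _) htcl,
    ← insert_empty_eq a, (algMatroid A.Ω).relRank_insert_eq_add_one (mem_univ _)
      (by rwa [empty_union]), relRank_empty, zero_add]
  rfl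

/-! ### Strongness of the steps and of the stages -/

/-- A subspace between `D` and `D + ℚa` is one of the two. [folklore] -/
theorem eq_or_eq_of_le_sup_span_singleton {D Y : Submodule ℚ A.Ω} {a : A.Ω} (h₁ : D ≤ Y)
    (h₂ : Y ≤ D ⊔ Submodule.span ℚ {a}) : Y = D ∨ Y = D ⊔ Submodule.span ℚ {a} := by
  classical
  by_cases hY : Y ≤ D
  · exact Or.inl (le_antisymm hY h₁)
  · right
    refine le_antisymm h₂ (sup_le h₁ ?_)
    rw [Submodule.span_singleton_le_iff_mem]
    obtain ⟨y, hyY, hyD⟩ := Set.not_subset.1 hY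
    have hy := h₂ hyY
    rw [Submodule.mem_sup] at hy
    obtain ⟨d, hd, z, hz, rfl⟩ := hy
    obtain ⟨q, rfl⟩ := Submodule.mem_span_singleton.1 hz
    have hq : q ≠ 0 := by
      rintro rfl
      exact hyD (by simpa using hd)
    have : a = q⁻¹ • ((d + q • a) - d) := by
      rw [add_sub_cancel_left, smul_smul, inv_mul_cancel₀ hq, one_smul]
    rw [this]
    exact Submodule.smul_mem _ _ (Submodule.sub_mem _ hyY (h₁ hd))

/-- **Each step is strong** (Kirby, Lemma 2.14): `δ(Y/Dₖ) ≥ 0` for `Dₖ ≤ Y ≤ D_{k+1}`.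
[cite: Kirby2013FPEF, Lemma 2.14] -/
theorem predim_step_nonneg (k : ℕ) {Y : Submodule ℚ A.Ω} (h₁ : (chain A k).D ≤ Y)
    (h₂ : Y ≤ (chain A (k + 1)).D) : 0 ≤ predim (chain A k).D Y := by
  rcases chain_succ_D k with heq | ⟨a, haD, heq, hrk⟩
  · rw [heq] at h₂
    rw [le_antisymm h₂ h₁, predim_self]
  · rw [heq] at h₂
    rcases eq_or_eq_of_le_sup_span_singleton h₁ h₂ with rfl | rfl
    · rw [predim_self]
    · rw [predim_sup_left, predim_def, ldim_span_singleton_of_not_mem haD, td_span_singleton]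
      have hfin : (algMatroid A.Ω).relRank (gens (chain A k).D) {a, ExponentialRing.exp a} ≠ ⊤ := by
        rw [← td_span_singleton]
        exact td_ne_top (isFG_span_of_finite _ (finite_singleton a))
      have h1 : 1 ≤ ((algMatroid A.Ω).relRank (gens (chain A k).D) {a, ExponentialRing.exp a}).toNat := by
        rw [← ENat.coe_toNat hfin] at hrk
        exact_mod_cast hrk
      omega

/-- Subspaces of a (finite-dimensional) stage are finitely generated. [folklore] -/
theorem fg_of_le_D {Y : Submodule ℚ A.Ω} {l : ℕ} (h : Y ≤ (chain A l).D) : Y.FG := by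
  haveI : FiniteDimensional ℚ (chain A l).D :=
    FiniteDimensional.span_of_finite ℚ (chain A l).s.finite_toSet
  haveI : FiniteDimensional ℚ Y := Submodule.finiteDimensional_of_le h
  exact (Submodule.fg_iff_finiteDimensional Y).2 inferInstance

/-- Subspaces of a stage are finitely generated over any base. [folklore] -/
theorem isFG_of_le_D (X : Submodule ℚ A.Ω) {Y : Submodule ℚ A.Ω} {l : ℕ} (h : Y ≤ (chain A l).D) :
    IsFG X Y :=
  (fg_of_le_D h).map _

/-- **`δ(Y/Dₖ) ≥ 0` for `Dₖ ≤ Y ≤ D_l`** (Kirby, Lemma 2.3: composites of strong extensions are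
strong), by induction on `l` using the addition formula and submodularity of `δ`.
[cite: Kirby2013FPEF, Lemma 2.3 and Lemma 2.14] -/
theorem predim_nonneg_of_le_of_le {k l : ℕ} (hkl : k ≤ l) {Y : Submodule ℚ A.Ω}
    (h₁ : (chain A k).D ≤ Y) (h₂ : Y ≤ (chain A l).D) : 0 ≤ predim (chain A k).D Y := by
  induction l, hkl using Nat.le_induction generalizing Y with
  | base => rw [le_antisymm h₂ h₁, predim_self]
  | succ l hkl ih =>
    have h1' : (chain A k).D ≤ Y ⊓ (chain A l).D := le_inf h₁ (D_mono hkl)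
    have hY' : 0 ≤ predim (chain A k).D (Y ⊓ (chain A l).D) := ih h1' inf_le_right
    have hadd : predim (chain A k).D Y =
        predim (chain A k).D (Y ⊓ (chain A l).D) + predim (Y ⊓ (chain A l).D) Y :=
      predim_add h1' inf_le_left (isFG_of_le_D _ h₂)
    have hsub : predim (chain A l).D (Y ⊔ (chain A l).D) ≤ predim (Y ⊓ (chain A l).D) Y :=
      predim_sup_le Y (chain A l).D (isFG_of_le_D _ h₂)
    have hstep : 0 ≤ predim (chain A l).D (Y ⊔ (chain A l).D) :=
      predim_step_nonneg l le_sup_right (sup_le h₂ (D_mono (Nat.le_succ l)))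
    linarith

/-- A finite set lies in some stage beyond any given one. [folklore] -/
theorem exists_subset_D {P : Set A.Ω} (hP : P.Finite) (k : ℕ) :
    ∃ l, k ≤ l ∧ P ⊆ (chain A l).D := by
  classical
  refine ⟨max k (hP.toFinset.sup stage), le_max_left _ _, fun p hp => ?_⟩
  have h1 : stage p ≤ hP.toFinset.sup stage := Finset.le_sup (hP.mem_toFinset.2 hp)
  exact D_mono (h1.trans (le_max_right _ _)) (mem_D_stage p)

/-- **Every stage is strong in `(Ω, exp)`** (Kirby, Lemma 2.3: `⋃ Fₙ` over a chain of strong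
extensions; Lemma 2.14). [cite: Kirby2013FPEF, Lemma 2.3 and Lemma 2.14] -/
theorem isStrong_D_chain (k : ℕ) : IsStrong (chain A k).D := by
  classical
  intro Y hle hfg
  obtain ⟨s, hsY, hYs⟩ := isFG_iff_exists_finset.1 hfg
  obtain ⟨l, hkl, hsl⟩ := exists_subset_D (s.finite_toSet) k
  have hYl : Y ≤ (chain A l).D :=
    hYs.trans (sup_le (D_mono hkl) (Submodule.span_le.2 hsl))
  exact predim_nonneg_of_le_of_le hkl hle hYl

/-! ### The axioms -/

/-- `τ = 2πi` is transcendental in `Ω`. [cite: Lindemann1882] -/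
theorem transcendental_τ : Transcendental ℚ A.τ := fun h =>
  PseudoExpAmbient.transcendental_twoPiI
    ((isAlgebraic_algebraMap_iff (A := ℂ) Subtype.val_injective).2 h)

/-- `exp τ = 1`. [folklore] -/
theorem exp_τ : (ExponentialRing.exp A.τ : A.Ω) = 1 :=
  Subtype.ext (by rw [coe_exp]; exact (Einf_eq_one_iff A.τ).2 ⟨1, by simp⟩)

/-- **The kernel is `τℤ`.** [cite: Kirby2013FPEF, Construction 2.11 and §2 (kernel-preserving)] -/
theorem expKernel_eq : expKernel A.Ω = AddSubgroup.zmultiples A.τ := by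
  ext x
  rw [mem_expKernel_iff, AddSubgroup.mem_zmultiples_iff]
  constructor
  · intro h
    have h' : Einf x = 1 := by
      have := congrArg Subtype.val h
      rwa [coe_exp] at this
    obtain ⟨n, rfl⟩ := (Einf_eq_one_iff x).1 h'
    exact ⟨n, rfl⟩
  · rintro ⟨n, rfl⟩
    exact Subtype.ext (by rw [coe_exp]; exact (Einf_eq_one_iff _).2 ⟨n, rfl⟩)

/-- **Standard kernel.** [cite: Kirby2013FPEF, Construction 2.11 (SK)] -/
theorem hasStandardKernel : HasStandardKernel A.Ω := ⟨A.τ, transcendental_τ, expKernel_eq⟩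

/-- **`SK ◁ (Ω, exp)`**: the base `ℚ · 2πi` is strong. [cite: Kirby2013FPEF, Lemma 2.14] -/
theorem isStrong_span_τ : IsStrong (Submodule.span ℚ ({A.τ} : Set A.Ω)) := by
  have : (chain A 0).D = Submodule.span ℚ ({A.τ} : Set A.Ω) := by
    change Submodule.span ℚ ((({A.τ} : Finset A.Ω)) : Set A.Ω) = _
    rw [Finset.coe_singleton]
  rw [← this]
  exact isStrong_D_chain 0

/-- **The Schanuel property** (= `0 ◁ F`, equivalently `SK ◁ F` given the standard kernel).
[cite: Kirby2013FPEF, Lemma 2.14] [cite: BaysKirby2018ANT, Thm 9.1 (proof)] -/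
theorem schanuelProperty : SchanuelProperty A.Ω :=
  (schanuelProperty_iff_isStrong_span_kernelGenerator transcendental_τ exp_τ).2 isStrong_span_τ

/-- **`exp` is onto `Ωˣ`**: every non-zero `b` has its logarithm task.
[cite: Kirby2013FPEF, Construction 2.13 (every element of F has a logarithm in F^l)] -/
theorem isSurjectiveOntoUnits : IsSurjectiveOntoUnits A.Ω := by
  classical
  intro b hb
  obtain ⟨l, hl⟩ := task_surjective A (Sum.inr (Sum.inl b))
  have hc : chain A (l + 1) = (chain A l).stepLog b := by
    rw [chain_succ, hl]; rfl
  unfold PState.stepLog at hc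
  split_ifs at hc with h
  · rcases h with h0 | ⟨x, hx, hEx⟩
    · exact (hb h0).elim
    · exact ⟨x, Subtype.ext (by rw [coe_exp_eq_E hx, hEx])⟩
  · push Not at h
    have hb0 : (b : ℂ) ≠ 0 := fun h0 => hb (Subtype.ext h0)
    set a := A.fresh ((chain A l).genℂ ∪ {(b : ℂ)})
      ((chain A l).genℂ_finite.union (finite_singleton _)) with ha
    have haD : a ∉ (chain A l).D := (chain A l).fresh_notMem_D _ subset_union_left
    have haD' : a ∈ (chain A (l + 1)).D := by
      rw [hc, PState.adjoin_D]; exact Submodule.mem_sup_right (Submodule.mem_span_singleton_self a)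
    refine ⟨a, Subtype.ext ?_⟩
    rw [coe_exp_eq_E haD', hc, PState.E_of_mem ((inv_chain l).adjoin haD
      (by rw [Complex.exp_log hb0]; exact b.2)).good (by simp), PState.adjoin_w_self,
      Complex.exp_log hb0]

/-- Generic tasks occur beyond any stage. [folklore] -/
theorem exists_gen_task_ge (k : ℕ) : ∃ l, k ≤ l ∧ ∃ j, task A l = Sum.inr (Sum.inr j) := by
  classical
  have hex : ∀ j : ℕ, ∃ l, task A l = Sum.inr (Sum.inr j) := fun j => task_surjective A _
  choose f hf using hex
  have hinj : Function.Injective f := fun i j hij => by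
    have := (hf i).symm.trans ((congrArg (task A) hij).trans (hf j))
    simpa using this
  by_contra hcon
  push Not at hcon
  have hlt : ∀ j, f j < k := fun j => by
    by_contra hge
    exact hcon (f j) (not_lt.1 hge) j (hf j)
  have hfin : Set.Finite (Set.range f) :=
    (Set.finite_Iio k).subset (by rintro _ ⟨j, rfl⟩; exact hlt j)
  exact (Set.infinite_range_of_injective hinj) hfin

/-- **Infinite dimension**: no finite subset is `ecl`-spanning. A generic generator `a` adjoined at
a stage `l` beyond the finite set has `δ(ℚa/D_l) = 1`, but every element of `ecl(D_l)` lies in a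
finitely generated `Y ⊇ D_l` with `δ(Y/D_l) ≤ 0` (Kirby 2010), and `D_{l+1} ◁ F` forces
`δ(Y/D_l) ≥ δ(D_{l+1}/D_l) = 1`. [cite: Kirby2010, Thm 1.3] [cite: Kirby2013FPEF, Lemma 2.14] -/
theorem ecl_ne_univ (P : Set A.Ω) (hP : P.Finite) : ecl P ≠ Set.univ := by
  classical
  obtain ⟨k, -, hk⟩ := exists_subset_D hP 0
  obtain ⟨l, hkl, j, htk⟩ := exists_gen_task_ge (A := A) k
  obtain ⟨a, haD, hD, hrk⟩ := chain_succ_D_of_gen htk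
  intro huniv
  have ha : a ∈ ecl (((chain A l).D : Submodule ℚ A.Ω) : Set A.Ω) := by
    refine ecl_mono (hk.trans ?_) (by rw [huniv]; exact mem_univ a)
    exact D_mono hkl
  obtain ⟨n, x, hax, hδ⟩ := exists_predim_le_zero_of_mem_ecl_coe (chain A l).D ha
  set Y : Submodule ℚ A.Ω := (chain A l).D ⊔ Submodule.span ℚ (range x) with hY
  have h1 : predim (chain A l).D Y ≤ 0 := by rw [hY, predim_sup_left]; exact hδ
  have hle : (chain A (l + 1)).D ≤ Y := by
    rw [hD]
    refine sup_le le_sup_left ?_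
    rw [Submodule.span_singleton_le_iff_mem]
    exact Submodule.mem_sup_right (Submodule.subset_span hax)
  have hfgl : IsFG (chain A l).D Y :=
    isFG_sup_left.2 (isFG_span_of_finite _ (finite_range x))
  have h2 : predim (chain A l).D Y =
      predim (chain A l).D (chain A (l + 1)).D + predim (chain A (l + 1)).D Y :=
    predim_add (D_mono (Nat.le_succ l)) hle hfgl
  have h3 : predim (chain A l).D (chain A (l + 1)).D = 1 := by
    rw [hD, predim_sup_left, predim_def, ldim_span_singleton_of_not_mem haD, td_span_singleton, hrk]
    rfl
  have h4 : 0 ≤ predim (chain A (l + 1)).D Y :=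
    isStrong_D_chain (l + 1) hle (hfgl.of_le_left (D_mono (Nat.le_succ l)))
  linarith

/-- **A countable ELA-field with standard kernel, the Schanuel property and infinite dimension**
(Kirby 2013, §2: the free ELA-closure `SK^{ELA}` — here with countably many extra exponentially
transcendental generators — is a countable ELA-field, the extension `SK ◁ SK^{ELA}` is strong
(Lemma 2.14), i.e. the Schanuel property holds, and it is kernel-preserving; realised inside `ℂ`).
[cite: Kirby2013FPEF, Constructions 2.11, 2.13 and Lemma 2.14] -/
theorem exists_countable_ELA_schanuel :
    ∃ (M : Type) (_ : Field M) (_ : CharZero M) (_ : ExponentialRing M),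
      Countable M ∧ IsAlgClosed M ∧ IsSurjectiveOntoUnits M ∧ HasStandardKernel M ∧
        SchanuelProperty M ∧ ∀ P : Set M, P.Finite → ecl P ≠ Set.univ := by
  obtain ⟨A⟩ := AmbientData.nonempty
  exact ⟨A.Ω, inferInstance, inferInstance, instExponentialRing A, A.countable, A.isAlgClosed,
    isSurjectiveOntoUnits, hasStandardKernel, schanuelProperty, ecl_ne_univ⟩

end Axioms

end PseudoExpChain

end Literature.NumberTheory.Transcendental
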